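import Literature.Probability.RandomPlanarGeometry.SAWAdsorptionIrreducibleBridges
import Mathlib.Data.List.GetD
import Mathlib.Algebra.BigOperators.Intervals
import Mathlib.Algebra.Order.Interval.Finset.SuccPred
import HarnessLib

/-!
# `a_c ≤ 2.09`: a kernel-certified census of irreducible wall-returning `x`-bridges (`m ≤ 16`) and
# `AdsorbedAbove (209/100) (269/100)`

Topic `Literature/Probability/RandomPlanarGeometry` (continues `SAWAdsorptionIrreducibleBridges.lean`: pieces `AdsIrr.IsWXB`,
irreducible pieces `AdsIrr.IsIrr`, `AdsIrr.visits`, `F_m(a) = AdsIrr.Fw m a`, and the certificate principle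
`AdsIrr.adsorbedAbove_of_irreducible_lowerBounds`; and `SAWAdsorptionUpperBound.lean`: `Zd.AdsorbedAbove`,
`Zd.adsorbedAbove_212`).

## Content

* A fast, verified acceptance test for one step word (`AdsIrr.irrOK m w`: length `m`, self-avoiding — read on the
  integer position list `AdsIrr.pts w`, one `scanl` — a piece, no renewal time) with its soundness
  `AdsIrr.irrOK_sound : irrOK m w = true → w.length = m ∧ IsIrr w`, and the wall-visit count `AdsIrr.visitsP`
  (`= AdsIrr.visits`).
* The list certificate `AdsIrr.certM m cs L`: every word of `L` passes `irrOK m`, `L` is strictly increasing in an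
  integer encoding (hence duplicate-free), and for each `v` at least `cs[v]` words of `L` have `v` wall visits;
  soundness `AdsIrr.sum_le_Fw_of_certM : certM m cs L = true → Σ_v cs[v] a^v ≤ F_m(a)` (`a ≥ 0`; standard axioms).
* An UNTRUSTED depth-first search `AdsIrr.dfs m` emitting the irreducible pieces of length `m` (pruned by the
  distance to the wall and to a new `x₁`-record; only its output is checked).
* The census `AdsIrr.cTab m` = numbers of irreducible pieces of length `m` by wall visits `v = 0, 1, 2, …`, for
  `m ≤ 16` — `c(1,1) = 1`, `c(4,2) = c(5,2) = 1`, `c(6,2) = 2`, …, `c(16,·) = (0,0,4004,1084,287,6)` (9 424 pieces in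
  all; these are the exact values of the lane's Engine-C census `D-ADSIRR`, job j172694, reproduced here by the
  kernel) — certified by one `native_decide` per length (`AdsIrr.cert_one`, …, `AdsIrr.cert_sixteen`).
* **`Zd.adsorbedAbove_209 : AdsorbedAbove (209/100) (269/100)`**: with `f_m = Σ_v c(m,v) (209/100)^v`,
  `Σ_{m ≤ 16} f_m (100/269)^m = 1.0015… ≥ 1` (`norm_num`), so `Z⁺_n(2.09) ≥ K · 2.69ⁿ`: the adsorbed free energy at
  `a = 2.09` is at least `log 2.69 > log μ(ℤ²)` (`μ ≤ 2.688`, `SAWFiniteMemory18`), i.e. **`a_c ≤ 2.09`** for the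
  Hammersley–Torrie–Whittington adsorption point (tree: `2.12`, `Zd.adsorbedAbove_212`, hook automaton; print:
  `1 < a_c ≤ μ`, numerically `a_c = 1.77564`, Beaton–Guttmann–Jensen 2012). Longer pieces improve this slowly
  (`m ≤ 20`: `2.07`; `m ≤ 30`: `2.034`).

Computational class: axioms standard plus the `native_decide` count certificates (`Lean.ofReduceBool`).
-/

open Finset Literature.Probability.LatticeModels SimpleGraph
open scoped BigOperators

namespace Literature.Probability.RandomPlanarGeometry.SAW

namespace AdsIrr

/-! ### The fast position list -/

/-- One step on integer coordinate pairs. [cite: MadrasSlade1993, §1.1] -/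
def pstep (p : ℤ × ℤ) (d : Step) : ℤ × ℤ := (p.1 + Step.dx d, p.2 + Step.dy d)

/-- The positions `(x₀, x₁)` of the walk at times `0, …, |w|`, by one `scanl`. [cite: MadrasSlade1993, §1.1] -/
def pts (w : List Step) : List (ℤ × ℤ) := w.scanl pstep (0, 0)

/-- Coordinate pair of a site. [cite: MadrasSlade1993, §1.1] -/
def toPair (s : Site 2) : ℤ × ℤ := (s 0, s 1)

/-- `toPair` is injective. [cite: MadrasSlade1993, §1.1] -/
theorem toPair_injective : Function.Injective toPair := by
  intro s t h
  simp only [toPair, Prod.mk.injEq] at h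
  funext j; fin_cases j
  · exact h.1
  · exact h.2

/-- `scanl f b l` lists the folds of the prefixes of `l`. [folklore] -/
private theorem scanl_eq_map_range' {α β : Type*} (f : β → α → β) (b : β) (l : List α) :
    List.scanl f b l = (List.range (l.length + 1)).map fun i => List.foldl f b (l.take i) := by
  induction l generalizing b with
  | nil => simp
  | cons x l ih =>
    rw [List.scanl_cons, ih, List.length_cons]
    conv_rhs => rw [List.range_succ_eq_map, List.map_cons, List.map_map]
    rfl

/-- Folding `pstep` computes the translate by the endpoint. [folklore] -/
private theorem foldl_pstep (u : List Step) (s : Site 2) : u.foldl pstep (toPair s) = toPair (s + wEnd u) := by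
  induction u generalizing s with
  | nil => simp
  | cons d u ih =>
    have h : pstep (toPair s) d = toPair (s + Step.vec d) := by
      simp [pstep, toPair]
    rw [List.foldl_cons, h, ih, wEnd_cons, add_assoc]

/-- **The fast position list is the true one**: `pts w = (verts w).map toPair`. [cite: MadrasSlade1993, §1.1] -/
theorem pts_eq_map (w : List Step) : pts w = (verts w).map toPair := by
  rw [pts, scanl_eq_map_range', verts, List.map_map]
  refine List.map_congr_left fun i _ => ?_
  have h := foldl_pstep (w.take i) 0
  have h0 : toPair 0 = ((0 : ℤ), (0 : ℤ)) := rfl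
  rw [h0] at h
  rw [Function.comp_apply, h, zero_add, traj]

/-- Self-avoidance read on the fast position list. [cite: MadrasSlade1993, Definition 1.1.1] -/
theorem nodup_pts_iff (w : List Step) : (pts w).Nodup ↔ IsSAW w := by
  rw [pts_eq_map]
  exact List.nodup_map_iff toPair_injective

/-- Length of the position list. [cite: MadrasSlade1993, §1.1] -/
theorem length_pts (w : List Step) : (pts w).length = w.length + 1 := by
  rw [pts, List.length_scanl]

/-- Entries of the position list. [cite: MadrasSlade1993, §1.1] -/
theorem pts_getD (w : List Step) {i : ℕ} (hi : i ≤ w.length) :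
    (pts w).getD i (0, 0) = (traj w i 0, traj w i 1) := by
  rw [pts_eq_map, List.getD_eq_getElem _ _ (by simp [verts]; omega)]
  simp [verts, toPair]

/-! ### The segment test -/

/-- Piece test for the segment `[a, a + b]` of a position list, in coordinates relative to time `a`:
heights `≥` and final height `=` the height at `a`; `x₁ ≥ x₁(a)` throughout and `x₁ < x₁(a+b)` before the end.
[cite: MadrasSlade1993, Definition 1.2.4 (p. 10)] -/
def segP (ps : List (ℤ × ℤ)) (a b : ℕ) : Bool :=
  decide ((ps.getD (a + b) (0, 0)).1 = (ps.getD a (0, 0)).1) &&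
  (List.range (b + 1)).all (fun i => decide ((ps.getD a (0, 0)).1 ≤ (ps.getD (a + i) (0, 0)).1 ∧
    (ps.getD a (0, 0)).2 ≤ (ps.getD (a + i) (0, 0)).2)) &&
  (List.range b).all fun i => decide ((ps.getD (a + i) (0, 0)).2 < (ps.getD (a + b) (0, 0)).2)

/-- The piece conditions for the segment `[a, a + b]` of the trajectory, relative to time `a`.
[cite: MadrasSlade1993, Definition 1.2.4 (p. 10)] -/
def SegProp (w : List Step) (a b : ℕ) : Prop :=
  traj w (a + b) 0 = traj w a 0 ∧ (∀ i ≤ b, traj w a 0 ≤ traj w (a + i) 0 ∧ traj w a 1 ≤ traj w (a + i) 1) ∧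
    ∀ i < b, traj w (a + i) 1 < traj w (a + b) 1

/-- `segP` on `pts w` is `SegProp w`. [cite: MadrasSlade1993, Definition 1.2.4 (p. 10)] -/
theorem segP_iff (w : List Step) {a b : ℕ} (hab : a + b ≤ w.length) : segP (pts w) a b = true ↔ SegProp w a b := by
  have e : ∀ i ≤ b, (pts w).getD (a + i) (0, 0) = (traj w (a + i) 0, traj w (a + i) 1) :=
    fun i hi => pts_getD w (by omega)
  have ea : (pts w).getD a (0, 0) = (traj w a 0, traj w a 1) := pts_getD w (by omega)
  simp only [segP, SegProp, Bool.and_eq_true, decide_eq_true_eq, List.all_eq_true, List.mem_range]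
  rw [ea, e b le_rfl]
  constructor
  · rintro ⟨⟨h1, h2⟩, h3⟩
    refine ⟨h1, fun i hi => ?_, fun i hi => ?_⟩
    · have := h2 i (Nat.lt_succ_of_le hi); rwa [e i hi] at this
    · have := h3 i hi; rwa [e i hi.le] at this
  · rintro ⟨h1, h2, h3⟩
    refine ⟨⟨h1, fun i hi => ?_⟩, fun i hi => ?_⟩
    · rw [e i (Nat.le_of_lt_succ hi)]; exact h2 i (Nat.le_of_lt_succ hi)
    · rw [e i hi.le]; exact h3 i hi

/-- A piece is a self-avoiding word satisfying `SegProp w 0 |w|`. [cite: MadrasSlade1993, Definition 1.2.4 (p. 10)] -/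
theorem isWXB_iff_segProp (w : List Step) : IsWXB w ↔ IsSAW w ∧ SegProp w 0 w.length := by
  simp only [IsWXB, SegProp, Nat.zero_add, traj_zero, traj_length, Pi.zero_apply]
  constructor
  · rintro ⟨hs, hh, he, hx, hr⟩
    exact ⟨hs, he, fun i hi => ⟨hh i hi, hx i hi⟩, hr⟩
  · rintro ⟨hs, he, hhx, hr⟩
    exact ⟨hs, fun i hi => (hhx i hi).1, he, fun i hi => (hhx i hi).2, hr⟩

/-- If a prefix is a piece, its segment passes. [cite: MadrasSlade1993, Definition 1.2.4 (p. 10)] -/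
theorem segProp_of_isWXB_take {w : List Step} {k : ℕ} (hk : k ≤ w.length) (h : IsWXB (w.take k)) :
    SegProp w 0 k := by
  rw [isWXB_iff_segProp] at h
  obtain ⟨-, h1, h2, h3⟩ := h
  have hl : (w.take k).length = k := by simp [min_eq_left hk]
  rw [hl] at h1 h2 h3
  have e : ∀ i ≤ k, traj (w.take k) i = traj w i := fun i hi => traj_take w hi
  simp only [SegProp, Nat.zero_add] at h1 h2 h3 ⊢
  refine ⟨by rw [← e k le_rfl, ← e 0 (Nat.zero_le _), h1], fun i hi => ?_, fun i hi => ?_⟩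
  · rw [← e 0 (Nat.zero_le _), ← e i hi]; exact h2 i hi
  · rw [← e i hi.le, ← e k le_rfl]; exact h3 i hi

/-- If a suffix is a piece, its segment passes. [cite: MadrasSlade1993, Definition 1.2.4 (p. 10)] -/
theorem segProp_of_isWXB_drop {w : List Step} {k : ℕ} (hk : k ≤ w.length) (h : IsWXB (w.drop k)) :
    SegProp w k (w.length - k) := by
  rw [isWXB_iff_segProp] at h
  obtain ⟨-, h1, h2, h3⟩ := h
  have hl : (w.drop k).length = w.length - k := by simp
  rw [hl] at h1 h2 h3
  have hlt : (w.take k).length = k := by simp [min_eq_left hk]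
  have e : ∀ i, traj w (k + i) = traj w k + traj (w.drop k) i := fun i => by
    have := traj_append_right (w.take k) (w.drop k) i
    rw [List.take_append_drop, hlt] at this
    rw [this]
    rfl
  have e0 : ∀ i, traj w (k + i) 0 = traj w k 0 + traj (w.drop k) i 0 := fun i => by rw [e i]; rfl
  have e1 : ∀ i, traj w (k + i) 1 = traj w k 1 + traj (w.drop k) i 1 := fun i => by rw [e i]; rfl
  simp only [SegProp, Nat.zero_add, traj_zero, Pi.zero_apply] at h1 h2 h3 ⊢
  refine ⟨by rw [e0, h1, add_zero], fun i hi => ⟨?_, ?_⟩, fun i hi => ?_⟩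
  · rw [e0]; linarith [(h2 i hi).1]
  · rw [e1]; linarith [(h2 i hi).2]
  · rw [e1, e1]; linarith [h3 i hi]

/-! ### Wall visits on the position list -/

/-- Number of positions at times `1, …, |w|` on the wall. [cite: BeatonGuttmannJensen2012Adsorption, §1 (p. 2)] -/
def visitsP (ps : List (ℤ × ℤ)) : ℕ := ∑ j ∈ range (ps.length - 1), if (ps.getD (j + 1) (0, 0)).1 = 0 then 1 else 0

/-- `visitsP (pts w) = visits w`. [cite: BeatonGuttmannJensen2012Adsorption, §1 (p. 2)] -/
theorem visitsP_pts (w : List Step) : visitsP (pts w) = visits w := by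
  unfold visitsP visits
  rw [length_pts, Nat.add_sub_cancel]
  refine Finset.sum_congr rfl fun j hj => ?_
  rw [Finset.mem_range] at hj
  rw [pts_getD w (by omega)]

/-! ### The verified acceptance test for one word -/

/-- **The acceptance test**: length `m ≥ 1`, self-avoiding (on `pts`), a piece (`segP 0 m`), and no renewal time
`k ∈ [1, m-1]`. [cite: MadrasSlade1993, Definition 4.2.1 (p. 89)] -/
def irrOK (m : ℕ) (w : List Step) : Bool :=
  let ps := pts w
  decide (w.length = m) && decide (1 ≤ m) && decide ps.Nodup && segP ps 0 m &&
    (List.range' 1 (m - 1)).all fun k => !(segP ps 0 k && segP ps k (m - k))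

/-- **Soundness of the acceptance test.** [cite: MadrasSlade1993, Definition 4.2.1 (p. 89)] -/
theorem irrOK_sound {m : ℕ} {w : List Step} (h : irrOK m w = true) : w.length = m ∧ IsIrr w := by
  simp only [irrOK, Bool.and_eq_true, decide_eq_true_eq, List.all_eq_true, List.mem_range'_1] at h
  obtain ⟨⟨⟨⟨hl, hm⟩, hnd⟩, hseg⟩, hno⟩ := h
  have hsaw : IsSAW w := (nodup_pts_iff w).1 hnd
  have hW : IsWXB w := (isWXB_iff_segProp w).2 ⟨hsaw, (segP_iff w (by omega)).1 (by rw [hl]; exact hseg)⟩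
  refine ⟨hl, hW, ?_, fun k hk hk0 hboth => ?_⟩
  · rintro rfl; simp at hl; omega
  · obtain ⟨ht, hd⟩ := hboth
    have h1 : segP (pts w) 0 k = true := (segP_iff w (by omega)).2 (segProp_of_isWXB_take hk.le ht)
    have h2 : segP (pts w) k (m - k) = true := by
      have := segProp_of_isWXB_drop hk.le hd
      rw [hl] at this
      exact (segP_iff w (by omega)).2 this
    have := hno k ⟨hk0, by omega⟩
    rw [h1, h2] at this
    simp at this

/-! ### The list certificate -/

/-- Integer encoding of a step word (base `5`, digits `d + 1`); used only to check that the emitted list is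
strictly increasing, hence duplicate-free. [cite: Jensen2004SAWLowerBounds, §2] -/
def enc (w : List Step) : ℕ := w.foldl (fun a d => a * 5 + (d.val + 1)) 0

/-- Strict order of encodings. [cite: Jensen2004SAWLowerBounds, §2] -/
def EncLT (v w : List Step) : Prop := enc v < enc w

/-- `EncLT` is decidable. [folklore] -/
instance : DecidableRel EncLT := fun v w => inferInstanceAs (Decidable (enc v < enc w))

/-- `EncLT` is transitive. [folklore] -/
instance : Trans EncLT EncLT EncLT := ⟨fun h₁ h₂ => lt_trans h₁ h₂⟩

/-- A list strictly increasing in `enc` has no duplicates. [folklore] -/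
private theorem nodup_of_chain' {L : List (List Step)} (h : L.IsChain EncLT) : L.Nodup :=
  h.pairwise.imp fun hab heq => by subst heq; exact lt_irrefl _ hab

/-- **The list certificate**: every word of `L` is an irreducible piece of length `m`, `L` is strictly increasing,
and for each `v < |cs|` at least `cs[v]` words of `L` have exactly `v` wall visits.
[cite: Jensen2004SAWLowerBounds, §2] -/
def certM (m : ℕ) (cs : List ℕ) (L : List (List Step)) : Bool :=
  L.all (irrOK m) && decide (L.IsChain EncLT) &&
    (List.range cs.length).all fun v => decide (cs.getD v 0 ≤ (L.filter fun w => visitsP (pts w) = v).length)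

/-- **Soundness of the list certificate**: `Σ_{v < |cs|} cs[v] · a^v ≤ F_m(a)` for `a ≥ 0`.
[cite: Jensen2004SAWLowerBounds, §2] [cite: MadrasSlade1993, Definition 4.2.1 (p. 89)] -/
theorem sum_le_Fw_of_certM {m : ℕ} {cs : List ℕ} {L : List (List Step)} {a : ℝ} (ha : 0 ≤ a)
    (h : certM m cs L = true) : ∑ v ∈ range cs.length, (cs.getD v 0 : ℝ) * a ^ v ≤ Fw m a := by
  classical
  simp only [certM, Bool.and_eq_true, decide_eq_true_eq, List.all_eq_true, List.mem_range] at h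
  obtain ⟨⟨hall, hchain⟩, hcount⟩ := h
  have hnd : L.Nodup := nodup_of_chain' hchain
  set T := L.toFinset with hT
  have hTsub : T ⊆ irrWords m := fun w hw => by
    have := irrOK_sound (hall w (List.mem_toFinset.1 hw))
    exact mem_irrWords.2 this
  have hcard : ∀ v, #(T.filter fun w => visits w = v) = (L.filter fun w => decide (visitsP (pts w) = v)).length :=
    fun v => by
    rw [← List.toFinset_card_of_nodup (hnd.filter _), List.toFinset_filter, hT]
    congr 1
    ext w
    simp only [Finset.mem_filter, List.mem_toFinset, decide_eq_true_eq, visitsP_pts]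
  have hfib : ∀ v, cs.getD v 0 ≤ #(T.filter fun w => visits w = v) := fun v => by
    by_cases hv : v < cs.length
    · rw [hcard]; exact hcount v hv
    · rw [List.getD_eq_default _ _ (by omega)]; exact Nat.zero_le _
  calc ∑ v ∈ range cs.length, (cs.getD v 0 : ℝ) * a ^ v
      ≤ ∑ v ∈ range cs.length, (#(T.filter fun w => visits w = v) : ℝ) * a ^ v :=
        Finset.sum_le_sum fun v _ => mul_le_mul_of_nonneg_right (by exact_mod_cast hfib v) (pow_nonneg ha _)
    _ = ∑ v ∈ range cs.length, ∑ w ∈ T.filter (fun w => visits w = v), a ^ visits w := by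
        refine Finset.sum_congr rfl fun v _ => ?_
        rw [Finset.sum_congr rfl (g := fun _ => a ^ v) fun w hw => by rw [(Finset.mem_filter.1 hw).2],
          Finset.sum_const, nsmul_eq_mul]
    _ = ∑ w ∈ T.filter (fun w => visits w ∈ range cs.length), a ^ visits w := by
        rw [← Finset.sum_fiberwise_of_maps_to (s := T.filter fun w => visits w ∈ range cs.length)
          (t := range cs.length) (g := fun w => visits w) (fun w hw => (Finset.mem_filter.1 hw).2)]
        refine Finset.sum_congr rfl fun v hv => Finset.sum_congr ?_ fun _ _ => rfl
        ext w
        simp only [Finset.mem_filter]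
        constructor
        · rintro ⟨hw, rfl⟩; exact ⟨⟨hw, hv⟩, rfl⟩
        · rintro ⟨⟨hw, -⟩, h⟩; exact ⟨hw, h⟩
    _ ≤ ∑ w ∈ irrWords m, a ^ visits w :=
        Finset.sum_le_sum_of_subset_of_nonneg (fun w hw => hTsub (Finset.mem_filter.1 hw).1)
          fun _ _ _ => pow_nonneg ha _
    _ = Fw m a := rfl

/-! ### The untrusted search -/

/-- Depth-first search over half-plane self-avoiding prefixes with `x₁ ≥ 0` (arguments: remaining steps, current
position, the maximum of `x₁` over EARLIER times, visited sites, the `x₁`-values of the live renewal candidates,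
the word so far reversed, accumulator). A branch is cut when the remaining steps cannot both return to the wall and
pass the running `x₁`-record; a candidate cut (a wall vertex at a new `x₁`-record) dies when a later site has
smaller `x₁`. At depth `m` the word is emitted iff it ends on the wall at a new record with no live candidate.
Untrusted: only the output is checked. [cite: Jensen2004SAWLowerBounds, §2] -/
def go : ℕ → ℤ × ℤ → ℤ → List (ℤ × ℤ) → List ℤ → List Step → List (List Step) → List (List Step)
  | 0, p, emaxPrev, _, cands, wr, acc =>
    if p.1 == 0 && decide (emaxPrev < p.2) && cands.isEmpty then wr.reverse :: acc else acc
  | r + 1, p, emaxPrev, vis, cands, wr, acc =>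
    let emax := max emaxPrev p.2
    let cands₁ := if !wr.isEmpty && p.1 == 0 && decide (emaxPrev < p.2) then p.2 :: cands else cands
    let ext : Step → List (List Step) → List (List Step) := fun d acc' =>
      let q := pstep p d
      if decide (q.1 < 0) || decide (q.2 < 0) || vis.elem q then acc'
      else
        let need := q.1 + (if decide (emax < q.2) then 0 else emax - q.2 + 1)
        if decide ((r : ℤ) < need) then acc'
        else go r q emax (q :: vis) (cands₁.filter fun c => decide (c ≤ q.2)) (d :: wr) acc'
    ext 0 (ext 1 (ext 2 (ext 3 acc)))

/-- The (untrusted) list of the irreducible pieces of length `m`, sorted by `enc`. [cite: Jensen2004SAWLowerBounds, §2] -/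
def dfs (m : ℕ) : List (List Step) :=
  (go m (0, 0) (-1) [(0, 0)] [] [] []).mergeSort fun a b => decide (enc a ≤ enc b)

/-! ### The census (computational class: one `native_decide` per length) -/

/-- `c(m, v)` = number of irreducible pieces of length `m` with `v` wall visits, `v = 0, 1, 2, …` (`m ≤ 16`; the
exact values; lengths `2, 3` have none). [cite: BeatonGuttmannJensen2012Adsorption, §1 (p. 2)] -/
def cTab : ℕ → List ℕ
  | 1 => [0, 1]
  | 4 => [0, 0, 1]
  | 5 => [0, 0, 1]
  | 6 => [0, 0, 2]
  | 7 => [0, 0, 4]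
  | 8 => [0, 0, 8]
  | 9 => [0, 0, 16, 2]
  | 10 => [0, 0, 33, 4]
  | 11 => [0, 0, 71, 14]
  | 12 => [0, 0, 154, 32, 3]
  | 13 => [0, 0, 342, 80, 5]
  | 14 => [0, 0, 768, 190, 38]
  | 15 => [0, 0, 1742, 446, 82, 4]
  | 16 => [0, 0, 4004, 1084, 287, 6]
  | _ => []

/-- `c(1, 1) ≥ 1`. [cite: BeatonGuttmannJensen2012Adsorption, §1 (p. 2)] -/
theorem cert_one : certM 1 (cTab 1) (dfs 1) = true := by native_decide

/-- `c(4, 2) ≥ 1`. [cite: BeatonGuttmannJensen2012Adsorption, §1 (p. 2)] -/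
theorem cert_four : certM 4 (cTab 4) (dfs 4) = true := by native_decide

/-- `c(5, 2) ≥ 1`. [cite: BeatonGuttmannJensen2012Adsorption, §1 (p. 2)] -/
theorem cert_five : certM 5 (cTab 5) (dfs 5) = true := by native_decide

/-- `c(6, 2) ≥ 2`. [cite: BeatonGuttmannJensen2012Adsorption, §1 (p. 2)] -/
theorem cert_six : certM 6 (cTab 6) (dfs 6) = true := by native_decide

/-- `c(7, 2) ≥ 4`. [cite: BeatonGuttmannJensen2012Adsorption, §1 (p. 2)] -/
theorem cert_seven : certM 7 (cTab 7) (dfs 7) = true := by native_decide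

/-- `c(8, 2) ≥ 8`. [cite: BeatonGuttmannJensen2012Adsorption, §1 (p. 2)] -/
theorem cert_eight : certM 8 (cTab 8) (dfs 8) = true := by native_decide

/-- `c(9, ·) ≥ (0, 0, 16, 2)`. [cite: BeatonGuttmannJensen2012Adsorption, §1 (p. 2)] -/
theorem cert_nine : certM 9 (cTab 9) (dfs 9) = true := by native_decide

/-- `c(10, ·) ≥ (0, 0, 33, 4)`. [cite: BeatonGuttmannJensen2012Adsorption, §1 (p. 2)] -/
theorem cert_ten : certM 10 (cTab 10) (dfs 10) = true := by native_decide

/-- `c(11, ·) ≥ (0, 0, 71, 14)`. [cite: BeatonGuttmannJensen2012Adsorption, §1 (p. 2)] -/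
theorem cert_eleven : certM 11 (cTab 11) (dfs 11) = true := by native_decide

/-- `c(12, ·) ≥ (0, 0, 154, 32, 3)`. [cite: BeatonGuttmannJensen2012Adsorption, §1 (p. 2)] -/
theorem cert_twelve : certM 12 (cTab 12) (dfs 12) = true := by native_decide

/-- `c(13, ·) ≥ (0, 0, 342, 80, 5)`. [cite: BeatonGuttmannJensen2012Adsorption, §1 (p. 2)] -/
theorem cert_thirteen : certM 13 (cTab 13) (dfs 13) = true := by native_decide

/-- `c(14, ·) ≥ (0, 0, 768, 190, 38)`. [cite: BeatonGuttmannJensen2012Adsorption, §1 (p. 2)] -/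
theorem cert_fourteen : certM 14 (cTab 14) (dfs 14) = true := by native_decide

/-- `c(15, ·) ≥ (0, 0, 1742, 446, 82, 4)`. [cite: BeatonGuttmannJensen2012Adsorption, §1 (p. 2)] -/
theorem cert_fifteen : certM 15 (cTab 15) (dfs 15) = true := by native_decide

/-- `c(16, ·) ≥ (0, 0, 4004, 1084, 287, 6)`. [cite: BeatonGuttmannJensen2012Adsorption, §1 (p. 2)] -/
theorem cert_sixteen : certM 16 (cTab 16) (dfs 16) = true := by native_decide

/-! ### Assembly -/

/-- The certified lower bound `f_m(a) = Σ_v c(m, v) a^v` on `F_m(a)`. [cite: BeatonGuttmannJensen2012Adsorption, §1 (p. 2)] -/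
noncomputable def fTab (a : ℝ) (m : ℕ) : ℝ := ∑ v ∈ range (cTab m).length, ((cTab m).getD v 0 : ℝ) * a ^ v

/-- `f_m(a) ≤ F_m(a)` for `1 ≤ m ≤ 16`, `a ≥ 0`. [cite: BeatonGuttmannJensen2012Adsorption, §1 (p. 2)] -/
theorem fTab_le_Fw {a : ℝ} (ha : 0 ≤ a) : ∀ m ∈ Icc 1 16, fTab a m ≤ Fw m a := by
  intro m hm
  rw [Finset.mem_Icc] at hm
  obtain ⟨h1, h16⟩ := hm
  unfold fTab
  interval_cases m
  · exact sum_le_Fw_of_certM ha cert_one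
  · simp only [show cTab 2 = [] from rfl, List.length_nil, Finset.range_zero, Finset.sum_empty]
    exact Fw_nonneg _ ha
  · simp only [show cTab 3 = [] from rfl, List.length_nil, Finset.range_zero, Finset.sum_empty]
    exact Fw_nonneg _ ha
  · exact sum_le_Fw_of_certM ha cert_four
  · exact sum_le_Fw_of_certM ha cert_five
  · exact sum_le_Fw_of_certM ha cert_six
  · exact sum_le_Fw_of_certM ha cert_seven
  · exact sum_le_Fw_of_certM ha cert_eight
  · exact sum_le_Fw_of_certM ha cert_nine
  · exact sum_le_Fw_of_certM ha cert_ten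
  · exact sum_le_Fw_of_certM ha cert_eleven
  · exact sum_le_Fw_of_certM ha cert_twelve
  · exact sum_le_Fw_of_certM ha cert_thirteen
  · exact sum_le_Fw_of_certM ha cert_fourteen
  · exact sum_le_Fw_of_certM ha cert_fifteen
  · exact sum_le_Fw_of_certM ha cert_sixteen

/-- The numeral: `Σ_{m=1}^{16} f_m(2.09) (100/269)^m ≥ 1` (`= 1.00152…`). [cite: BeatonGuttmannJensen2012Adsorption, §1 (p. 2)] -/
theorem one_le_sum_fTab_209 : (1 : ℝ) ≤ ∑ m ∈ Icc 1 16, fTab (209 / 100) m / (269 / 100) ^ m := by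
  rw [← Finset.Ico_add_one_right_eq_Icc, Finset.sum_Ico_eq_sum_range]
  simp only [Finset.sum_range_succ, Finset.sum_range_zero, fTab, cTab, List.length_cons, List.length_nil,
    List.getD_cons_zero, List.getD_cons_succ, Nat.reduceAdd]
  norm_num

end AdsIrr

/-- **`AdsorbedAbove (209/100) (269/100)`: `Z⁺_n(2.09) ≥ K · 2.69ⁿ` for every `n`** — the adsorbed free energy at
fugacity `a = 2.09` is at least `log 2.69 > log 2.688 ≥ log μ(ℤ²)`, so the Hammersley–Torrie–Whittington adsorption
point satisfies `a_c ≤ 2.09` (tree: `2.12`, `adsorbedAbove_212`; printed window `1 < a_c ≤ μ`, numerics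
`a_c = 1.775`). Certificate: the kernel-counted irreducible wall-returning `x`-bridges of length `≤ 16`.
[cite: BeatonGuttmannJensen2012Adsorption, §1 (p. 2)] [cite: MadrasSlade1993, §4.2, eq. (4.2.2)–(4.2.4) (pp. 89–91)] -/
theorem Zd.adsorbedAbove_209 : Zd.AdsorbedAbove (209 / 100) (269 / 100) :=
  AdsIrr.adsorbedAbove_of_irreducible_lowerBounds (by norm_num) (by norm_num) (AdsIrr.fTab (209 / 100))
    (AdsIrr.fTab_le_Fw (by norm_num)) AdsIrr.one_le_sum_fTab_209

end Literature.Probability.RandomPlanarGeometry.SAW
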